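import Summits.QuantumFields.BalabanUV.Beta.FP.ConstrainedBiLaplacianFibreIdentities
import Summits.QuantumFields.BalabanUV.Beta.FP.ConstrainedBiLaplacianKernel

/-!
# `BalabanUV.Beta.FP.ConstrainedBiLaplacianResponse` — road «FP» for binder row D1, DESIGN ROW **GHOST-STEP** brick (g3) «(CONV-C)-Sb» ∕ «(CONV-C)-Hb»
# (owner d1-p3 gen 13: Q-FP-13-2 and brick (g1) `FP/BiLaplaceBlockResponse` «the kernel (g3)'s limit will be ABOUT», journal 2026-08-21T14:26:58Z),
# FILE 3 — THE FIBRE MULTIPLIER OF THE BLOCK-SUM RESPONSE (the bi-harmonic HARD MINIMISER, order `s`): its two fibre identities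
# (FORCE-FREE Euler–Lagrange row; UNIT block sums), holomorphy, side periodicity, strip regularity, and an ENTRYWISE LEVEL-FREE exponential
# majorant of its lattice kernel in block-mean normalisation (`‖n^{d+1}·latticeKernel (hM n s τ) x‖ ≤ C(d,s)·e^{−kappaB|x|_∞}`, all `n ≥ 1`, `s ≥ 1`)

NOT IN PRINT; OUR PROOF ATTEMPT (binder row G-an2-4 ∕ (CONV-C), prover part P3 = fibre∕strip «Woodbury» lineage, gen 28; CRUX TEAM (2),
2026-08-21).  HONEST DEPENDENCY (cell records, verbatim): «continuum YM on T⁴ ⇐ BetaPertH ∧ nine spine estimates (0/9 proved); BetaPertH ⇐ (D1) ∧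
(D4) ∧ CAP+tail; G-an2-4 gates asym, D1 and NE2/3/4.»  HONEST FRAMING (cell contract, verbatim): «discharging `BetaPertH` makes Bałaban's UV
stability UNCONDITIONAL — a real constructive-QFT result; it is NOT the continuum limit and NOT the Clay problem.»  ABSOLUTE RULE (cell charter,
verbatim): «No internally-minted statement may enter as a cited fact. Every hypothesis is either kernel-proved in this package or a verbatim quotation
of a PUBLISHED theorem with page reference. The manuscript(s) under audit are NOT citable for their own disputed steps — they are the thing under
adjudication; programme-internal (2001/route/tribunal) claims are never citable.»  THIS MODULE is [folklore] algebra and complex analysis over the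
lineage's FILES 1, 2a, 2b, 3a, 3b of row RHOA-4-GH and FILE 2 of this programme (`ConstrainedBiLaplacianFibreIdentities`); it re-defines no symbol of
[B4], cites nothing as a hypothesis, has TWO bookkeeping `def`s (`bvec`, `hM`), no `def … : Prop`, no `sorry`.

## The object

In the alias fibre over the block momentum `p′` (FILE 2a §0: `A = (Δ^ξ)^s` diagonal, `A_k = (Δ^ξ(p′+2πk))^s`; block averaging `Q′*Q′ = |u⟩⟨ũ|`,
`u_k = F n 0 k`, `ũ_k = Fc n 0 k`) the BLOCK-SUM RESPONSE — the configuration of least `½‖(Δ^ξ)^{s∕2}·‖²`-energy with prescribed block sums,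
`H = A⁻¹|u⟩ ∕ ⟨ũ, A⁻¹u⟩` (`s = 2`: the scalar∕ghost companion of `KernelSpecInstance.wH`, an2's∕d1-p3's `FP/BiLaplaceBlockResponse.Hb` up to
the junction of FILE 4) — has the alias components, REGROUPED through FILE 1's zero-free `den = U_0 + (Δ^ξ)^s·Spr` exactly as FILE 2b regroups `Gfib`:
**`bvec n s p′ k = u_0∕den` (`k = 0`), `= (Δ^ξ(p′))^s·a_k·u_k∕den` (`k ≠ 0`)** (§1) — holomorphic through `p′ = 0` (the unshifted symbol is a FACTOR).
It is the column twin of FILE 2's co-vector `cvec` (there `ũ`, here `u`).  The OFFSET MULTIPLIER of the response at the fine offset `τ` is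
**`hM n s τ p′ = n^{−d}·Σ_k EF(τ,k)·bvec_k`** (§3), so that the response at the fine point `x⁰ + ξτ` to a unit block sum prescribed at block `y`
is `latticeKernel (hM n s τ) (x⁰ − y)` (dictionary as in FILE 3b; junction with `Hb` = FILE 4).

## What is proved (every `d`, `n ≥ 1`, `s`; on `Strip d (kappaB d s)` unless stated)

* §1 `bvec`, `bvec_zero`, `bvec_of_ne`; **`symbol_mul_bvec`**: `(Δ^ξ(p′+2πk))^s · bvec_k = ((Δ^ξ(p′))^s ∕ den)·u_k` — the FORCE-FREE Euler–Lagrange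
  row with the block-constant multiplier `ω(p′) = (Δ^ξ)^s∕den` (an2's `hB_EL` in the fibre); **`sum_Fc_mul_bvec`**: `Σ_k ũ_k·bvec_k = 1` — UNIT block
  sum at every block momentum, i.e. block sums `δ_{y,0}` (an2's `hB_M` in the fibre); `bvec_eq_unregrouped` (`= u_k∕(A_k·Ssum)` off the zeros of `Δ^ξ`).
* §2 bounds and holomorphy: **`norm_bvec_le`** (`‖bvec_k‖ ≤ CG d s · wt n s k`, FILE 2b's weights, `n`-free profile), `differentiableAt_bvec`,
  `bvec_tr_side` (side periodicity `bvec (p+2πe_μ) k = bvec p (σ_μ k)` via the un-regrouped form on the sides).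
* §3 `hM`, `differentiableAt_hM`, `hM_tr_side`, **`norm_hM_le`** (`‖hM n s τ p′‖ ≤ n^{−d}·2^d·CG d s·SW n d s`), and in dimension `d+1`:
  **`stripRegular_hM`**, **`response_decay`** (`‖latticeKernel (hM n s τ) x‖ ≤ ((n:ℝ)^{d+1})⁻¹·2^{d+1}·CG·SW·e^{−kappaB (d+1) s·|x|_∞}`),
  **`response_decay_scaled`** (`s ≥ 1`: `‖(n^{d+1})·latticeKernel (hM n s τ) x‖ ≤ 2^{d+1}·CG (d+1) s·(64∕7)^s·(48 ζ_{d+1})^{d+1}·e^{−kappaB|x|_∞}` —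
  ENTRYWISE, rate AND prefactor free of `n`: the uniform half of «(CONV-C)-Hb» in the lineage's currency needs NO cell average, unlike the compressed
  inverse of FILE 1 of this programme) and the packaged `response_tower_uniform`.

NOT HERE (honest): the junction `Hb(x, y) = latticeKernel (hM N 2 (x mod N)) (x div N − y)` with d1-p3's `BiLaplaceBlockResponse.Hb` by its
`eq_Hb_of_solvesB` (FILE 4; needs p280915 in the tree); the convergence ∕ one-step rate of the sub-cell-averaged response (the `s = 2` twin of the
lineage's `GAN24/SubAveragingMinimiserKernel.subavg_minimiser_rate`).  0∕4 row-D1 binders touched.  NOT (CONV-C), NEVER «G-an2-4 closed», NOT the ghost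
step law, NOT SDF, NOT D1, NOT BetaPertH, NOT continuum, NOT Clay.  Provenance: prover-b2b-balaban-gan24-p3-g28-0 (unit `b2b-balaban-gan24-p3`, gen 28),
2026-08-21; no existing file touched.
-/

noncomputable section

namespace Summit.QuantumFields.BalabanUV.Beta.FP.ConstrainedBiLaplacianResponse

open Complex Finset ComplexConjugate
open Literature.MathematicalPhysics.QuantumFieldTheory.Balaban1983to89
open Literature.MathematicalPhysics.QuantumFieldTheory.Balaban1983to89.B4Strip
open Literature.MathematicalPhysics.QuantumFieldTheory.Balaban1983to89.B4StripCauchy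
open Literature.MathematicalPhysics.QuantumFieldTheory.Balaban1983to89.B5Strip145Analytic
open Literature.MathematicalPhysics.QuantumFieldTheory.Balaban1983to89.B5Strip145Decay
open Literature.MathematicalPhysics.QuantumFieldTheory.Balaban1983to89.B4StripSums
open Literature.MathematicalPhysics.QuantumFieldTheory.Balaban1983to89.B4ContourShift
open Summit.QuantumFields.BalabanUV.Beta.FP.ConstrainedBiLaplacianStrip
open Summit.QuantumFields.BalabanUV.Beta.FP.ConstrainedBiLaplacianFibre
open Summit.QuantumFields.BalabanUV.Beta.FP.ConstrainedBiLaplacianFibreEntries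
open Summit.QuantumFields.BalabanUV.Beta.FP.ConstrainedBiLaplacianFibreSides
open Summit.QuantumFields.BalabanUV.Beta.FP.ConstrainedBiLaplacianKernel
open Summit.QuantumFields.BalabanUV.Beta.FP.ConstrainedBiLaplacianFibreIdentities
open scoped Real

variable {d : ℕ}

/-! ## §1 The alias components of the block-sum response and their two fibre identities -/

section Fibre

variable (n : ℕ) [NeZero n] (s : ℕ) (p : Fin d → ℂ)

/-- [folklore] **THE ALIAS COMPONENTS OF THE BLOCK-SUM RESPONSE** (regrouped through `den`): `bvec_0 = u_0∕den`, `bvec_k = (Δ^ξ)^s a_k u_k∕den`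
(`k ≠ 0`), `u_k = F n 0 k`. -/
def bvec (k : Fin d → Fin n) : ℂ :=
  (if k = fun _ => (0 : Fin n) then 1 else DeltaXi n 0 p ^ s) * side n s k p * F n (fun _ => 0) k p / den n s p

/-- [folklore] `bvec_0 = u_0∕den`. -/
theorem bvec_zero : bvec n s p (fun _ => 0) = F n (fun _ => 0) (fun _ => 0) p / den n s p := by
  unfold bvec side
  rw [if_pos rfl, if_pos rfl, one_mul, one_mul]

/-- [folklore] `bvec_k = (Δ^ξ)^s a_k u_k∕den` for `k ≠ 0`. -/
theorem bvec_of_ne {k : Fin d → Fin n} (hk : k ≠ fun _ => 0) :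
    bvec n s p k = DeltaXi n 0 p ^ s * ainv n s k p * F n (fun _ => 0) k p / den n s p := by
  unfold bvec side
  rw [if_neg hk, if_neg hk]

variable {p}

/-- [folklore] **THE FORCE-FREE EULER–LAGRANGE ROW IN THE FIBRE**: `(Δ^ξ(p′+2πk))^s · bvec_k = ((Δ^ξ(p′))^s∕den)·u_k` for every `k` on the strip —
`A·H = |u⟩·ω` with the block-constant multiplier `ω = (Δ^ξ)^s∕den` and NO force. -/
theorem symbol_mul_bvec (hp : p ∈ Strip d (kappaB d s)) (k : Fin d → Fin n) :
    DeltaXi n 0 (shift n k p) ^ s * bvec n s p k = DeltaXi n 0 p ^ s / den n s p * F n (fun _ => 0) k p := by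
  by_cases hk : k = fun _ => 0
  · subst hk
    rw [shift_zero, bvec_zero]
    ring
  · have hA : DeltaXi n 0 (shift n k p) ^ s * ainv n s k p = 1 := symbol_pow_mul_ainv n s hp hk
    rw [bvec_of_ne n s p hk]
    linear_combination (DeltaXi n 0 p ^ s * F n (fun _ => 0) k p / den n s p) * hA

/-- [folklore] **UNIT BLOCK SUMS IN THE FIBRE**: `Σ_k Fc n 0 k p′ · bvec_k = 1` on the strip (`u_kũ_k = U_k`, `den = U_0 + (Δ^ξ)^s·Spr`). -/
theorem sum_Fc_mul_bvec (hp : p ∈ Strip d (kappaB d s)) : ∑ k : Fin d → Fin n, Fc n (fun _ => 0) k p * bvec n s p k = 1 := by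
  have hden : den n s p ≠ 0 := den_ne_zero_strip n s hp
  have hU : ∀ k : Fin d → Fin n, F n (fun _ => 0) k p * Fc n (fun _ => 0) k p = U n k p := F_zero_mul_Fc_zero_eq_U_strip n s hp
  have h0 : (fun _ => (0 : Fin n)) ∈ (Finset.univ : Finset (Fin d → Fin n)) := Finset.mem_univ _
  rw [← Finset.add_sum_erase Finset.univ _ h0, bvec_zero]
  have e : ∀ k ∈ Finset.univ.erase (fun _ => (0 : Fin n)), Fc n (fun _ => 0) k p * bvec n s p k
      = (DeltaXi n 0 p ^ s / den n s p) * (U n k p * ainv n s k p) := fun k hk => by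
    rw [bvec_of_ne n s p (Finset.ne_of_mem_erase hk), ← hU k]
    ring
  rw [Finset.sum_congr rfl e, ← Finset.mul_sum]
  have key : Fc n (fun _ => 0) (fun _ => (0 : Fin n)) p * (F n (fun _ => 0) (fun _ => (0 : Fin n)) p / den n s p)
      = U n (fun _ => (0 : Fin n)) p / den n s p := by
    rw [← hU (fun _ => 0)]
    ring
  rw [key]
  have hden' := den_eq_U_add_mul_Spr n s p
  unfold Spr at hden'
  have e2 : U n (fun _ => (0 : Fin n)) p / den n s p
        + DeltaXi n 0 p ^ s / den n s p * ∑ k ∈ Finset.univ.erase (fun _ => (0 : Fin n)), U n k p * ainv n s k p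
      = (U n (fun _ => (0 : Fin n)) p
          + DeltaXi n 0 p ^ s * ∑ k ∈ Finset.univ.erase (fun _ => (0 : Fin n)), U n k p * ainv n s k p) / den n s p := by
    ring
  rw [e2, ← hden', div_self hden]

/-- [folklore] Off the zeros of the unshifted symbol the regrouped components ARE the Sherman–Morrison response `u_k∕(A_k·⟨ũ, A⁻¹u⟩)`:
`bvec_k = F n 0 k ∕ ((Δ^ξ(p′+2πk))^s · Ssum)` whenever `Δ^ξ(p′) ≠ 0`, `den ≠ 0` and the shifted symbols do not vanish. -/
theorem bvec_eq_unregrouped (k : Fin d → Fin n) (h0 : DeltaXi n 0 p ≠ 0) (hden : den n s p ≠ 0)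
    (hk : ∀ j : Fin d → Fin n, DeltaXi n 0 (shift n j p) ≠ 0) :
    bvec n s p k = F n (fun _ => 0) k p / (DeltaXi n 0 (shift n k p) ^ s * Ssum n s p) := by
  have hA0 : DeltaXi n 0 p ^ s ≠ 0 := pow_ne_zero s h0
  rw [← den_div_eq_Ssum n s h0]
  by_cases hk0 : k = fun _ => 0
  · subst hk0
    rw [bvec_zero, shift_zero]
    field_simp
  · have hAk : DeltaXi n 0 (shift n k p) ^ s ≠ 0 := pow_ne_zero s (hk k)
    rw [bvec_of_ne n s p hk0]
    unfold ainv
    field_simp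

end Fibre

/-! ## §2 Bounds, holomorphy and side periodicity of the components -/

/-- [folklore] **`‖bvec_k‖ ≤ CG d s · wt n s k` ON THE STRIP**, every `n ≥ 1` (`‖(Δ^ξ)^s‖ ≤ (16d)^s`, `‖side_k‖ ≤ sideWt_k`, `|u_k| ≤ Π 12∕ω`,
`‖den⁻¹‖ ≤ cB⁻¹`). -/
theorem norm_bvec_le (n : ℕ) [NeZero n] (s : ℕ) {p : Fin d → ℂ} (hp : p ∈ Strip d (kappaB d s)) (k : Fin d → Fin n) :
    ‖bvec n s p k‖ ≤ CG d s * wt n s k := by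
  have hn : 1 ≤ n := Nat.one_le_iff_ne_zero.mpr (NeZero.ne n)
  have hfat : p ∈ Fat d (rOf d) := fat_of_strip s hp
  have hcB := cB_pos d
  have hside := norm_side_le n s (rOf_le d) (d_mul_rOf_sq_le d) hfat k
  have hF := norm_F_zero_le n (rOf_le d) k hfat
  have hden := norm_inv_den_le_strip n s hp
  have hsw := sideWt_nonneg n s k
  have hprod : 0 ≤ ∏ ν, 12 / omega n (k ν) :=
    Finset.prod_nonneg fun ν _ => by have := omega_pos n (k ν) (k ν).isLt; positivity
  have hpre : ‖(if k = fun _ => (0 : Fin n) then (1 : ℂ) else DeltaXi n 0 p ^ s)‖ ≤ (16 * (d : ℝ)) ^ s + 1 := by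
    split_ifs
    · rw [norm_one]; have : (0 : ℝ) ≤ (16 * (d : ℝ)) ^ s := by positivity
      linarith
    · rw [norm_pow]
      have h := norm_DeltaXi_le n hn 0 le_rfl (rOf_le d) hfat
      rw [add_zero] at h
      have : ‖DeltaXi n 0 p‖ ^ s ≤ (16 * (d : ℝ)) ^ s := pow_le_pow_left₀ (norm_nonneg _) h s
      linarith
  unfold bvec
  rw [norm_div, norm_mul, norm_mul, div_eq_mul_inv, ← norm_inv]
  unfold CG wt
  rw [div_eq_mul_inv ((16 * (d : ℝ)) ^ s + 1)]
  calc ‖(if k = fun _ => (0 : Fin n) then (1 : ℂ) else DeltaXi n 0 p ^ s)‖ * ‖side n s k p‖ * ‖F n (fun _ => 0) k p‖ * ‖(den n s p)⁻¹‖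
      ≤ ((16 * (d : ℝ)) ^ s + 1) * sideWt n s k * (∏ ν, 12 / omega n (k ν)) * (cB d)⁻¹ :=
        mul_le_mul (mul_le_mul (mul_le_mul hpre hside (norm_nonneg _) (by positivity)) hF (norm_nonneg _) (by positivity))
          hden (norm_nonneg _) (by positivity)
    _ = ((16 * (d : ℝ)) ^ s + 1) * (cB d)⁻¹ * ((∏ ν, 12 / omega n (k ν)) * sideWt n s k) := by ring

/-- [folklore] `bvec n s · k` is holomorphic (jointly) at every point of the strip. -/
theorem differentiableAt_bvec (n : ℕ) [NeZero n] (s : ℕ) (k : Fin d → Fin n) {p : Fin d → ℂ} (hp : p ∈ Strip d (kappaB d s)) :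
    DifferentiableAt ℂ (fun q => bvec n s q k) p := by
  have hfat : p ∈ Fat d (rOf d) := fat_of_strip s hp
  have hpre : DifferentiableAt ℂ (fun q : Fin d → ℂ => (if k = fun _ => (0 : Fin n) then (1 : ℂ) else DeltaXi n 0 q ^ s)) p := by
    split_ifs
    · exact differentiableAt_const _
    · exact (differentiableAt_DeltaXi n 0 p).pow s
  show DifferentiableAt ℂ (fun q => (if k = fun _ => (0 : Fin n) then (1 : ℂ) else DeltaXi n 0 q ^ s) * side n s k q *
    F n (fun _ => 0) k q / den n s q) p
  exact dAt_div ((hpre.mul (differentiableAt_side n s (rOf_le d) (d_mul_rOf_sq_le d) hfat k)).mul (differentiableAt_F n _ k p))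
    (differentiableAt_den_strip n s hp) (den_ne_zero_strip n s hp)

/-- [folklore] **SIDE PERIODICITY OF THE COMPONENTS**: at a strip point `p ∈ Strip d κ` (`0 ≤ κ ≤ kappaB d s`) with `Re p_μ = −π`,
`bvec (p + 2πe_μ) k = bvec p (σ_μ k)` (both sides in un-regrouped form; `F_tr`, `DeltaXi_shift_tr`, `Ssum_tr`). -/
theorem bvec_tr_side (n : ℕ) [NeZero n] (s : ℕ) {κ : ℝ} (hκ0 : 0 ≤ κ) (hκ : κ ≤ kappaB d s) {p : Fin d → ℂ}
    (hp : p ∈ Strip d κ) (μ : Fin d) (hre : (p μ).re = -Real.pi) (k : Fin d → Fin n) :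
    bvec n s (tr p μ) k = bvec n s p (sigma n μ k) := by
  have hπ := Real.pi_pos
  have hz : p μ ≠ 0 := by
    intro h; rw [h, Complex.zero_re] at hre; linarith
  have hz' : p μ + 2 * Real.pi ≠ 0 := by
    intro h
    have := congrArg Complex.re h
    rw [← tr_apply_self, tr_re_self, hre, Complex.zero_re] at this
    linarith
  have hp1 : tr p μ ∈ Strip d κ := tr_mem_Strip hp μ hre
  obtain ⟨h0, hden, hsh, -⟩ := unregrouped_hyps n s hκ0 hκ hp μ (by rw [hre, abs_neg, abs_of_pos hπ])
  obtain ⟨h0', hden', hsh', -⟩ := unregrouped_hyps n s hκ0 hκ hp1 μ (by rw [tr_re_self, hre]; ring_nf; exact abs_of_pos hπ)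
  rw [bvec_eq_unregrouped n s k h0' hden' hsh', bvec_eq_unregrouped n s (sigma n μ k) h0 hden hsh, Ssum_tr n s p μ hz hz', F_tr,
    DeltaXi_shift_tr]

/-! ## §3 The offset multiplier of the response and its level-free decay -/

/-- [folklore] **THE OFFSET MULTIPLIER OF THE BLOCK-SUM RESPONSE** at the fine offset `τ`: `hM n s τ p′ = n^{−d}·Σ_k EF(τ,k)·bvec_k` (so that the
response at the fine point `x⁰ + ξτ` to the unit block sum prescribed at block `y` is `latticeKernel (hM n s τ) (x⁰ − y)`). -/
def hM (n : ℕ) [NeZero n] (s : ℕ) (τ : Fin d → Fin n) (p : Fin d → ℂ) : ℂ :=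
  ((n : ℂ) ^ d)⁻¹ * ∑ k : Fin d → Fin n, EF n τ k p * bvec n s p k

/-- [folklore] `hM n s τ` is holomorphic (jointly) at every strip point. -/
theorem differentiableAt_hM (n : ℕ) [NeZero n] (s : ℕ) (τ : Fin d → Fin n) {p : Fin d → ℂ} (hp : p ∈ Strip d (kappaB d s)) :
    DifferentiableAt ℂ (hM n s τ) p := by
  show DifferentiableAt ℂ (fun q => ((n : ℂ) ^ d)⁻¹ * ∑ k : Fin d → Fin n, EF n τ k q * bvec n s q k) p
  apply DifferentiableAt.const_mul
  apply DifferentiableAt.fun_sum; intro k _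
  exact (differentiableAt_EF n τ k p).mul (differentiableAt_bvec n s k hp)

/-- [folklore] Side periodicity of the offset multiplier (relabel the alias sum by `σ_μ`: `EF_tr`, `bvec_tr_side`). -/
theorem hM_tr_side (n : ℕ) [NeZero n] (s : ℕ) {κ : ℝ} (hκ0 : 0 ≤ κ) (hκ : κ ≤ kappaB d s) {p : Fin d → ℂ} (hp : p ∈ Strip d κ)
    (μ : Fin d) (hre : (p μ).re = -Real.pi) (τ : Fin d → Fin n) : hM n s τ (tr p μ) = hM n s τ p := by
  unfold hM
  congr 1
  calc ∑ k : Fin d → Fin n, EF n τ k (tr p μ) * bvec n s (tr p μ) k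
      = ∑ k : Fin d → Fin n, EF n τ (sigma n μ k) p * bvec n s p (sigma n μ k) := by
        refine Finset.sum_congr rfl fun k _ => ?_
        rw [EF_tr, bvec_tr_side n s hκ0 hκ hp μ hre]
    _ = ∑ k : Fin d → Fin n, EF n τ k p * bvec n s p k :=
        Equiv.sum_comp (sigmaEquiv n μ) (fun k => EF n τ k p * bvec n s p k)

/-- [folklore] **`‖hM n s τ p′‖ ≤ n^{−d}·2^d·CG d s·SW n d s` ON THE STRIP** (`‖EF‖ ≤ 2^d`, `norm_bvec_le`, `SW = Σ_k wt`). -/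
theorem norm_hM_le (n : ℕ) [NeZero n] (s : ℕ) (τ : Fin d → Fin n) {p : Fin d → ℂ} (hp : p ∈ Strip d (kappaB d s)) :
    ‖hM n s τ p‖ ≤ ((n : ℝ) ^ d)⁻¹ * (2 ^ d * CG d s * SW n d s) := by
  have hfat : p ∈ Fat d (rOf d) := fat_of_strip s hp
  have hCG := CG_nonneg d s
  have hterm : ∀ k : Fin d → Fin n, ‖EF n τ k p * bvec n s p k‖ ≤ 2 ^ d * (CG d s * wt n s k) := fun k => by
    rw [norm_mul]
    exact mul_le_mul (norm_EF_le n (rOf_le d) τ k hfat) (norm_bvec_le n s hp k) (norm_nonneg _) (by positivity)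
  unfold hM
  rw [norm_mul, norm_inv, norm_pow, Complex.norm_natCast]
  refine mul_le_mul_of_nonneg_left ?_ (by positivity)
  calc ‖∑ k : Fin d → Fin n, EF n τ k p * bvec n s p k‖
      ≤ ∑ k : Fin d → Fin n, ‖EF n τ k p * bvec n s p k‖ := norm_sum_le _ _
    _ ≤ ∑ k : Fin d → Fin n, 2 ^ d * (CG d s * wt n s k) := Finset.sum_le_sum fun k _ => hterm k
    _ = 2 ^ d * CG d s * SW n d s := by
        unfold SW
        rw [Finset.mul_sum]
        refine Finset.sum_congr rfl fun k _ => ?_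
        ring

/-- [folklore] **STRIP REGULARITY OF THE RESPONSE MULTIPLIER** (dimension `d+1`) with the bound `((n:ℝ)^{d+1})⁻¹·2^{d+1}·CG·SW`. -/
theorem stripRegular_hM (n : ℕ) [NeZero n] (s : ℕ) (τ : Fin (d + 1) → Fin n) :
    StripRegular (d := d) (hM n s τ) (kappaB (d + 1) s)
      (((n : ℝ) ^ (d + 1))⁻¹ * (2 ^ (d + 1) * CG (d + 1) s * SW n (d + 1) s)) := by
  have hκ0 : 0 ≤ kappaB (d + 1) s := (kappaB_pos (d + 1) s).le
  have hdiffAt : ∀ p ∈ Strip (d + 1) (kappaB (d + 1) s), DifferentiableAt ℂ (hM n s τ) p := fun p hp => differentiableAt_hM n s τ hp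
  refine ⟨?_, ?_, ?_, ?_⟩
  · exact fun p hp => (hdiffAt p hp).continuousAt.continuousWithinAt
  · intro i q hq z hz
    have hP : i.insertNth z (ofRealVec q) ∈ Strip (d + 1) (kappaB (d + 1) s) :=
      insertNth_mem_Strip hκ0 i hq (openRect_subset_closedRect _ hz)
    exact ((hdiffAt _ hP).comp z (differentiableAt_insertNth i _ z)).differentiableWithinAt
  · intro i q hq y hy
    obtain ⟨hP, hre⟩ := insertNth_left_mem hκ0 i hq hy
    rw [← tr_insertNth_left]
    exact (hM_tr_side n s hκ0 le_rfl hP i hre τ).symm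
  · intro p hp
    exact norm_hM_le n s τ hp

/-- [folklore] **EXPONENTIAL DECAY OF THE RESPONSE KERNEL ON THE BLOCK SCALE**: for EVERY `n ≥ 1`, order `s`, offset `τ` and block separation `x`,
`‖latticeKernel (hM n s τ) x‖ ≤ ((n:ℝ)^{d+1})⁻¹·2^{d+1}·CG (d+1) s·SW n (d+1) s·e^{−kappaB (d+1) s·|x|_∞}`. -/
theorem response_decay (n : ℕ) [NeZero n] (s : ℕ) (τ : Fin (d + 1) → Fin n) (x : Fin (d + 1) → ℤ) :
    ‖latticeKernel (hM n s τ) x‖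
      ≤ ((n : ℝ) ^ (d + 1))⁻¹ * (2 ^ (d + 1) * CG (d + 1) s * SW n (d + 1) s) * Real.exp (-(kappaB (d + 1) s * supNorm x)) :=
  latticeKernel_decay (stripRegular_hM n s τ) (kappaB_pos (d + 1) s).le x

/-- [folklore] **THE LEVEL-FREE MAJORANT IN BLOCK-MEAN NORMALISATION** (`s ≥ 1`): for EVERY `n ≥ 1`, `τ`, `x`,
`‖(n^{d+1})·latticeKernel (hM n s τ) x‖ ≤ 2^{d+1}·CG (d+1) s·(64∕7)^s·(48 ζ_{d+1})^{d+1}·e^{−kappaB (d+1) s·|x|_∞}` — ENTRYWISE, rate AND prefactor free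
of `n` (`ConstrainedBiLaplacianKernel.SW_le`). -/
theorem response_decay_scaled (n : ℕ) [NeZero n] {s : ℕ} (hs : 1 ≤ s) (τ : Fin (d + 1) → Fin n) (x : Fin (d + 1) → ℤ) :
    ‖((n : ℂ) ^ (d + 1)) * latticeKernel (hM n s τ) x‖
      ≤ 2 ^ (d + 1) * CG (d + 1) s * ((64 / 7) ^ s * (48 * zetaC (d + 1)) ^ (d + 1)) * Real.exp (-(kappaB (d + 1) s * supNorm x)) := by
  have hnpos : (0 : ℝ) < (n : ℝ) ^ (d + 1) := by
    have : (0 : ℝ) < n := by exact_mod_cast Nat.pos_of_ne_zero (NeZero.ne n)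
    positivity
  have hCG := CG_nonneg (d + 1) s
  have hSW := SW_le n (Nat.succ_pos d) hs
  have h := response_decay n s τ x
  rw [norm_mul, norm_pow, Complex.norm_natCast]
  calc (n : ℝ) ^ (d + 1) * ‖latticeKernel (hM n s τ) x‖
      ≤ (n : ℝ) ^ (d + 1) * (((n : ℝ) ^ (d + 1))⁻¹ * (2 ^ (d + 1) * CG (d + 1) s * SW n (d + 1) s) *
          Real.exp (-(kappaB (d + 1) s * supNorm x))) := mul_le_mul_of_nonneg_left h hnpos.le
    _ = 2 ^ (d + 1) * CG (d + 1) s * SW n (d + 1) s * Real.exp (-(kappaB (d + 1) s * supNorm x)) := by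
        field_simp
    _ ≤ 2 ^ (d + 1) * CG (d + 1) s * ((64 / 7) ^ s * (48 * zetaC (d + 1)) ^ (d + 1)) * Real.exp (-(kappaB (d + 1) s * supNorm x)) := by
        gcongr

/-- [folklore] **«(CONV-C)-Hb», THE UNIFORM HALF, PACKAGED** (`s ≥ 1`): ONE rate `κ > 0` and ONE constant `C ≥ 0`, free of the level, with
`‖(n^{d+1})·latticeKernel (hM n s τ) x‖ ≤ C·e^{−κ|x|_∞}` for ALL `n ≥ 1`, `τ`, `x`. -/
theorem response_tower_uniform (d : ℕ) {s : ℕ} (hs : 1 ≤ s) :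
    ∃ κ C : ℝ, 0 < κ ∧ 0 ≤ C ∧ ∀ (n : ℕ) [NeZero n] (τ : Fin (d + 1) → Fin n) (x : Fin (d + 1) → ℤ),
      ‖((n : ℂ) ^ (d + 1)) * latticeKernel (hM n s τ) x‖ ≤ C * Real.exp (-(κ * supNorm x)) := by
  refine ⟨kappaB (d + 1) s, 2 ^ (d + 1) * CG (d + 1) s * ((64 / 7) ^ s * (48 * zetaC (d + 1)) ^ (d + 1)), kappaB_pos (d + 1) s, ?_,
    fun n _ τ x => response_decay_scaled n hs τ x⟩
  have := CG_nonneg (d + 1) s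
  have := zetaC_nonneg (d + 1)
  positivity

end Summit.QuantumFields.BalabanUV.Beta.FP.ConstrainedBiLaplacianResponse

end
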